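import Literature.Barriers.RiemannHypothesis.BeurlingCounterexamplesThm13Proofs
import Literature.NumberTheory.BeurlingPrimes.RationalPrimes
import Literature.NumberTheory.LFunctions.QuasiRHFacts

/-!
# The integer-regularity window `β₀ > 2/5` cannot force square-root prime counting
For every `β₀ > 2/5`, «every Beurling system with `N_P(x) = ax + O_ε(x^{β+ε})` for some `β < β₀` has
`ψ_P(x) = x + O_ε(x^{1/2+ε})» is FALSE unconditionally: under RH an `[α, 2α/(α+2)]`-system of
[cite: BrouckeDebruyneRevesz2023, Theorem 1.3] refutes it, under `¬RH` the rational primes do (von Koch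
converse). The window `0 < β₀ ≤ 2/5` is not touched. Nothing here bears on the truth of RH. -/
open Filter Asymptotics Literature.NumberTheory.BeurlingPrimes Literature.NumberTheory.LFunctions

namespace Literature.Barriers.RiemannHypothesis

/-- **X_{β₀}**: integers counted with exponent `< β₀` force `ψ`-exponent `≤ 1/2` («`β < β₀` ⇒ primes
`1/2`-well-behaved», `[α, β]`-system language). [cite: BrouckeDebruyneRevesz2023, §1 p. 3 with Theorem 1.3] -/
def BetaWindowHalf (β₀ : ℝ) : Prop :=
  ∀ (P : BeurlingPrimes) (a β : ℝ), 0 < a → 0 ≤ β → β < β₀ →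
    (∀ ε : ℝ, 0 < ε → P.IntErrorLE a (β + ε)) → ∀ ε : ℝ, 0 < ε → P.PrimeErrorLE (1 / 2 + ε)

/-- `X_{β₀} → RH` for `β₀ > 0`: apply it to `(ℙ, ℕ)` and use the von Koch converse `ψ(x) − x = O(x^{σ₀}) ⇒
`ζ ≠ 0` on `Re s > σ₀` (tree `quasiRiemannHypothesis_of_chebyshevPsi_isBigO_holds`). [cite: MontgomeryVaughan2007, §15.1] -/
theorem riemannHypothesis_of_betaWindowHalf {β₀ : ℝ} (hβ₀ : 0 < β₀) (h : BetaWindowHalf β₀) :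
    RiemannHypothesis := by
  have hψ : ∀ ε : ℝ, 0 < ε → ratPrimes.PrimeErrorLE (1 / 2 + ε) :=
    h ratPrimes 1 0 one_pos le_rfl hβ₀ fun ε hε ↦ by simpa using ratPrimes_intErrorLE hε.le
  refine riemannHypothesis_of_forall_quasiRiemannHypothesis
    quasiRiemannHypothesis_one_half_iff_holds fun σ₀ hσ₀ ↦
    quasiRiemannHypothesis_of_chebyshevPsi_isBigO_holds σ₀ (by linarith) ?_
  obtain ⟨C, hC⟩ := hψ (σ₀ - 1 / 2) (by linarith)
  refine IsBigO.of_bound |C| ?_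
  filter_upwards [eventually_ge_atTop (1 : ℝ)] with x hx
  have h1 := hC x hx
  rw [chebyshevPsi_ratPrimes, show 1 / 2 + (σ₀ - 1 / 2) = σ₀ by ring] at h1
  have hx0 : 0 ≤ x ^ σ₀ := Real.rpow_nonneg (by linarith) _
  rw [Real.norm_eq_abs, Real.norm_eq_abs, abs_of_nonneg hx0]
  exact h1.trans (mul_le_mul_of_nonneg_right (le_abs_self C) hx0)

/-- **`X_{β₀}` is false for every `β₀ > 2/5`** [cite: BrouckeDebruyneRevesz2023, Theorem 1.3]. -/
theorem not_betaWindowHalf_of_two_fifths_lt {β₀ : ℝ} (hβ₀ : 2 / 5 < β₀) : ¬ BetaWindowHalf β₀ := by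
  intro h
  have hRH := riemannHypothesis_of_betaWindowHalf (by linarith) h
  set β₁ := min β₀ (1 / 2)
  have h1 : 2 / 5 < β₁ := lt_min hβ₀ (by norm_num)
  have h2 : β₁ ≤ 1 / 2 := min_le_right _ _
  have h3 : β₁ ≤ β₀ := min_le_left _ _
  obtain ⟨α, hα1, hα2⟩ := exists_between (show (1 : ℝ) / 2 < 2 * β₁ / (2 - β₁) by
    rw [lt_div_iff₀ (by linarith)]; linarith)
  have hα2' : α * (2 - β₁) < 2 * β₁ := by rwa [lt_div_iff₀ (by linarith)] at hα2
  have hα3 : α < 2 / 3 := by nlinarith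
  have hlt : 2 * α / (α + 2) < β₁ := by rw [div_lt_iff₀ (by linarith)]; nlinarith
  obtain ⟨P, hP⟩ := (BrouckeDebruyneRevesz2023_thm13_holds hRH).2 α (2 * α / (α + 2)) hα1 hα3 le_rfl
    (by linarith)
  obtain ⟨-, -, hβ0, -, a, ha, hN, -, -, hψ⟩ := hP
  have hε : 0 < (α - 1 / 2) / 2 := by linarith
  have h4 := h P a _ ha hβ0 (by linarith) hN ((α - 1 / 2) / 2) hε
  rw [show 1 / 2 + (α - 1 / 2) / 2 = α - (α - 1 / 2) / 2 by ring] at h4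
  exact hψ _ hε h4

end Literature.Barriers.RiemannHypothesis
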